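import Summits.QuantumAdvantage.QuantumAdvantage.Theses.WhiteBoxWalk
import Literature.Computability.Cryptography.YaoAmplification

/-!
# Route `WhiteBoxWalk` — route-posited objects for crux `WbwThesis` (stmt-QuantumAdvantage-2238), line `Sketch`

D-0016 `<Route>Defs` file. NOTHING IS ASSERTED here: definitions, plus `rfl`/bookkeeping lemmas
(lengths, values of the codecs) needed to *state* the line's stubs.

The line (crux-lead reshaping of card `yao-keyless-factoring`, Cruxes/WbwThesis/PICKED.md) is a
kernel-checked REDUCTION of `WbwThesis` (X, "planted unique-answer white-box quantum advantage") to
the standard FACTORING ASSUMPTION, through four theorems the tree already proves: Yao's amplification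
(`Yao.Params.isOneWay_g` with `yaoFun_polyTime_holds`, `yaoRun_polyTime_holds`), Shor's factoring
theorem in FBQP form (`factoring_mem_FBQP_holds`), AKS (`PRIMES_mem_P_holds`, `primeFn_mem_FP`) and
the classical wrap of quantum search (`isQSolvable_classicalWrap_dep`). Objects:

* `encW m v` (width-`m` LSB-first numeral), `pOf x` / `qOf x` (the numbers on the two halves of a
  block `x`, `m = ⌊|x|/2⌋` bits each; a trailing odd bit is ignored), `isPrimePair x` (both halves are
  `m`-bit primes; Boolean);
* `fPQ` — the PRIME-PAIR PRODUCT function (Goldreich's candidate `f_mult`, [Goldreich 2001, §2.2.4.1],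
  with the hard branch certified by AKS and tagged): `x ↦ 1 · encW |x| (P·Q)` on the hard branch,
  `x ↦ 0 · x` otherwise; `|fPQ x| = |x| + 1`; injective up to the order of the two primes and the
  ignored bit, so it has CANONICAL PREIMAGES `invPQ` (split `N` at its least prime factor);
* `qPQ = 32 X² + 32` (the weak-hardness polynomial), `pqParams : Yao.Params := ⟨fPQ, qPQ, X + 1⟩`,
  the instance generator `genPQ := pqParams.g` (Yao's direct product of `fPQ`, strongly one-way under
  the factoring assumption), `yaoPre P c` (blockwise canonical preimage of a Yao product), `prePQ`,
  and the ANSWER `ansPQ w = prePQ w ++ 0…0` (zero-padded to `|genPQ w|`);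
* `bigProd w` (product of the hard-branch block semiprimes — the ONE number the quantum side factors)
  and `factorCode N` (the output convention of `factoring_mem_FBQP`).

The line's one conjecture-grade hypothesis, the standard average-case FACTORING ASSUMPTION
[Goldreich 2001, §2.2.4.1; Katz–Lindell 2014, §8.2.3], is NOT defined here: it is literature
(`Literature.Computability.Cryptography.FactoringAssumption`, proposed `@[conjecture]`).

References: O. Goldreich, *Foundations of Cryptography I* (2001), §2.2.4.1 (the factoring assumption
and `f_mult`), Thm. 2.3.2 (Yao); J. Katz, Y. Lindell, *Introduction to Modern Cryptography* (2nd ed.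
2014), §8.2.3 (the factoring assumption relative to `GenModulus`); P. Shor, SIAM J. Comput. 26 (1997) §5;
M. Agrawal, N. Kayal, N. Saxena, Ann. Math. 160 (2004).
-/

noncomputable section

set_option linter.dupNamespace false -- D-0017: single-problem summit ⇒ `QuantumAdvantage.QuantumAdvantage` by design

namespace Summit.QuantumAdvantage.QuantumAdvantage.Theorems.WhiteBoxWalk

open Literature.Computability.Cryptography Literature.Computability.Complexity
open _root_.Computability Polynomial Filter Asymptotics

/-! ### Fixed-width numerals and the two halves of a block -/

/-- `encW m v`: the binary numeral of `v` (Mathlib's `encodeNat`, least significant bit first), cut or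
zero-padded to width exactly `m`; `bitsToNat (encW m v) = v % 2 ^ m`. -/
def encW (m v : ℕ) : List Bool :=
  (encodeNat v).take m ++ List.replicate (m - (encodeNat v).length) false

/-- `pOf x`: the number written (LSB first) on the first `⌊|x|/2⌋` bits of `x`. -/
def pOf (x : List Bool) : ℕ := bitsToNat (x.take (x.length / 2))

/-- `qOf x`: the number written on the next `⌊|x|/2⌋` bits of `x` (a trailing bit of an odd-length `x`
is ignored). -/
def qOf (x : List Bool) : ℕ := bitsToNat ((x.drop (x.length / 2)).take (x.length / 2))

/-- The HARD BRANCH test of `fPQ` (a Boolean, decided in polynomial time by AKS): both halves of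
`x` are `m`-bit primes, `m = ⌊|x|/2⌋` (top bit set, `2^{m-1} ≤ ·`; `< 2^m` is automatic). Never
`true` for `m ≤ 1`. -/
def isPrimePair (x : List Bool) : Bool :=
  decide ((pOf x).Prime ∧ (qOf x).Prime ∧ 2 ^ (x.length / 2 - 1) ≤ pOf x ∧ 2 ^ (x.length / 2 - 1) ≤ qOf x)

/-- `isPrimePair` unfolded to the mathematical predicate. -/
theorem isPrimePair_eq_true_iff (x : List Bool) :
    isPrimePair x = true ↔
      (pOf x).Prime ∧ (qOf x).Prime ∧ 2 ^ (x.length / 2 - 1) ≤ pOf x ∧ 2 ^ (x.length / 2 - 1) ≤ qOf x := by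
  simp [isPrimePair]

/-- **`fPQ`, the prime-pair product function.** On the hard branch (`isPrimePair x`, decided in
polynomial time by AKS) output the tag `1` followed by the width-`|x|` numeral of `P · Q`; otherwise
output the tag `0` followed by `x` itself. `|fPQ x| = |x| + 1` always; a preimage of a hard-branch
image reveals `{P, Q}`. [Goldreich 2001, §2.2.4.1 (`f_mult`)] -/
def fPQ (x : List Bool) : List Bool :=
  if isPrimePair x then true :: encW x.length (pOf x * qOf x) else false :: x

/-- The weak-hardness polynomial of `fPQ`: `q(n) = 32 n² + 32` (every PPT inverter fails with
probability `≥ 1/q(n)` for large `n`, from the prime-pair density `≥ 1/(16 m²)`, `m = ⌊n/2⌋`). -/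
def qPQ : Polynomial ℕ := C 32 * X ^ 2 + C 32

/-- The Yao parameters of the line: `f = fPQ`, hardness polynomial `qPQ`, output-length bound `X + 1`. -/
def pqParams : Yao.Params := ⟨fPQ, qPQ, X + 1⟩

/-- **The instance generator** `genPQ = g_{fPQ}`: Yao's direct product of `fPQ` (the tree's
`Yao.Params.g`: on `w` of length `m`, with block length `n = nOf m`, the framed list of the padded
`fPQ`-images of the `t(n) = n·q(n)` leading `n`-blocks, then the untouched suffix). -/
def genPQ : List Bool → List Bool := pqParams.g

/-- The CANONICAL `fPQ`-PREIMAGE of length `n` of an `fPQ`-image: a hard-branch image `1 · body`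
(`N = bitsToNat body`) is split at the least prime factor, `(minFac N, N / minFac N)`, each written on
`⌊n/2⌋` bits, plus a zero filler bit when `n` is odd; an easy-branch image `0 · x` returns `x`. -/
def invPQ (n : ℕ) : List Bool → List Bool
  | true :: body =>
      encW (n / 2) (bitsToNat body).minFac ++ encW (n / 2) (bitsToNat body / (bitsToNat body).minFac) ++
        List.replicate (n - 2 * (n / 2)) false
  | false :: x => x
  | [] => []

/-- Blockwise canonical preimage for a Yao product `P.g`: with `n = nOf |w|` and `t = t(n)`, replace
each of the `t` leading `n`-blocks `x_j` of `w` by `c n (f x_j)` and keep the suffix. -/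
def yaoPre (P : Yao.Params) (c : ℕ → List Bool → List Bool) (w : List Bool) : List Bool :=
  ((List.range (P.T (P.nOf w.length))).flatMap fun j =>
      c (P.nOf w.length) (P.f (Yao.blk (P.nOf w.length) j w))) ++
    w.drop (P.nOf w.length * P.T (P.nOf w.length))

/-- The canonical `genPQ`-preimage of `genPQ w` (a function of `genPQ w` alone). -/
def prePQ : List Bool → List Bool := yaoPre pqParams invPQ

/-- **The answer map** of the line: the canonical preimage zero-padded to the instance length,
`|ansPQ w| = |genPQ w|`. -/
def ansPQ (w : List Bool) : List Bool :=
  prePQ w ++ List.replicate ((genPQ w).length - w.length) false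

/-- The product of the hard-branch block semiprimes of `w` (easy-branch blocks contribute `1`): the
single integer whose prime factorisation the quantum side computes. -/
def bigProd (w : List Bool) : ℕ :=
  ((List.range (pqParams.T (pqParams.nOf w.length))).map fun j =>
      if isPrimePair (Yao.blk (pqParams.nOf w.length) j w) then
        pOf (Yao.blk (pqParams.nOf w.length) j w) * qOf (Yao.blk (pqParams.nOf w.length) j w)
      else 1).prod

/-- The code of the prime factorisation of `N` (non-decreasing, with multiplicity) — the output
convention of the tree's `factoring_mem_FBQP`. -/
def factorCode (N : ℕ) : List Bool := encodingListNatBool.encode N.primeFactorsList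

/-! ### Bookkeeping lemmas (codecs, lengths) -/

/-- `encW m v` has length exactly `m`. -/
@[simp] theorem length_encW (m v : ℕ) : (encW m v).length = m := by
  simp only [encW, List.length_append, List.length_take, List.length_replicate]
  omega

/-- `|fPQ x| = |x| + 1`. -/
@[simp] theorem length_fPQ (x : List Bool) : (fPQ x).length = x.length + 1 := by
  unfold fPQ; split_ifs <;> simp

/-- The output-length bound of the Yao parameters holds: `|fPQ x| ≤ (X + 1)(|x|)`. -/
theorem pqParams_lenBound : pqParams.LenBound := fun x => by
  show (fPQ x).length ≤ (X + 1 : Polynomial ℕ).eval x.length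
  simp

/-- The hardness polynomial is positive. -/
theorem pqParams_qpos : pqParams.QPos := fun n => by
  show 0 < (C 32 * X ^ 2 + C 32 : Polynomial ℕ).eval n
  simp

/-- `genPQ` unfolds to the Yao product of `pqParams`. -/
theorem genPQ_eq : genPQ = pqParams.g := rfl

/-- `pqParams.f = fPQ`. -/
@[simp] theorem pqParams_f : pqParams.f = fPQ := rfl

/-- `pqParams.q = qPQ`. -/
@[simp] theorem pqParams_q : pqParams.q = qPQ := rfl

/-- `pqParams.p = X + 1`. -/
@[simp] theorem pqParams_p : pqParams.p = X + 1 := rfl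

/-- `|ansPQ w| = |genPQ w|` provided `|prePQ w| = |w| ≤ |genPQ w|` (both proved by the line's canon stub). -/
theorem length_ansPQ {w : List Bool} (h1 : (prePQ w).length = w.length) (h2 : w.length ≤ (genPQ w).length) :
    (ansPQ w).length = (genPQ w).length := by
  simp only [ansPQ, List.length_append, List.length_replicate, h1]
  omega

end Summit.QuantumAdvantage.QuantumAdvantage.Theorems.WhiteBoxWalk

end
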